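import Summits.NavierStokesRegularity.NavierStokesRegularity.Theorems.NoOverheating.Negative.LadderLimitExposed
import Literature.Analysis.FluidPDE.OseenZoomCovariance
import Literature.Analysis.FluidPDE.MildSolutionIsometryCovariance
import Literature.Analysis.FluidPDE.ForcedOseenMildPeriodic
import Literature.Analysis.FluidPDE.KatoCaloricField
import Literature.Analysis.FluidPDE.AncientMildDrift
import HarnessLib

/-!
# PARITY-ODD Type-I ancient mild solutions are trivial, and no admissible window sequence is
# ASYMPTOTICALLY parity-odd — in particular not asymptotically EVEN `uₙ(t,x) − uₙ(t,−x) → 0`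
# (route `AngularGalerkinLadder`, crux K2 `NoOverheating`; census stratum, Negative lane, theorems only)

Cell `ns-blowup`, seat `ns-blowup-circuit` (g12, AGL Lean seat; INSTRUMENT for
`stmt-NavierStokesRegularity-19960` per DIRECTOR-NS #85 (3)). Companion of the K1 filters N7/N7′
(`OddProfilesExcluded`, `SymmetryOddRungSolutionsExcluded`): the same parity principle at the level
of the LADDER LIMIT (`exists_ladderLimit_typeI`, KJ-33a), hence a SEQUENCE-level stratum with an
asymptotic hypothesis, in the shape of refuter g18's census (next to (S18)–(S20)
`AsymptoticSymmetryWindowsExcluded`: axisymmetric / screw / steady).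

## The Liouville theorem (`typeIAncientMild_eq_zero_of_parityOdd`)

Let `v` be a Type-I ancient mild solution in the KNSS gauge (`IsTypeIAncientMild C v`: Oseen–Duhamel
identity `v(t) = e^{(t−s)Δ}v(s) − B_s(v,v)(t)` for all `s < t < 0`, `‖v(t,x)‖ ≤ C/√(−t)`) and let
`σ` be ANY linear isometry of `ℝ³` with `σv(t, σ⁻¹x) = −v(t, x)` for `t < 0` (`σ = −1`: even
slices; a mirror: mirror-odd slices; …). Conjugating the Duhamel identity by `σ` (heat flow and
Oseen tensor are `O(3)`-covariant: `heatFlow_conj_linearIsometryEquiv`,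
`oseenDuhamel_symm_conj_linearIsometryEquiv`) and using that `B_s` is BILINEAR — even in an odd
field — gives `−v(t) = −e^{(t−s)Δ}v(s) − B_s(v,v)(t)`; adding, `B_s(v,v)(t) = 0`, so
`v(t) = e^{(t−s)Δ}v(s)` for every `s < t`: `v` is caloric from every past time, and the maximum
principle with the Type-I rate, `‖v(t,x)‖ ≤ C/√(−s) → 0` as `s → −∞`, gives `v ≡ 0`.

## The stratum (`no_windowSequence_asymptoticallyParityOdd`)

For an admissible window sequence (common `C₀`, `[cmin, cmax]`, floor `δ > 0`, defect sizes
`εₙ → 0`) and a linear isometry `σ`: if `σuₙ(t, σ⁻¹x) + uₙ(t, x) → 0` pointwise on `t < 0`, the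
ladder limit is parity-odd, hence zero — against the inherited floor `δ ≤ ‖v(−1, x₀)‖`. Instances:
**`no_windowSequence_asymptoticallyEven`** (`uₙ(t, x) − uₙ(t, −x) → 0`), census forms.

LABEL: KERNEL, unconditional. WHAT THIS IS NOT: not Navier–Stokes evidence; no window sequence is
constructed; sequences without an asymptotic odd parity are untouched. References:
[cite: KochNadirashviliSereginSverak2009, §4 p. 8 (the bilinear form), Lemma 6.1 (limits of rescaled solutions)];
[cite: MajdaBertozziCUP2002, §1.2 Prop. 1.1 (iii)] (isometry covariance).
-/

noncomputable section

namespace Summit.NavierStokesRegularity.AngularGalerkinLadderParityOddWindowsExcluded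

open Set Function Filter Topology MeasureTheory
open Literature.Analysis.FluidPDE
open Summit.NavierStokesRegularity.FluidComputer Summit.NavierStokesRegularity.FluidComputer.AngularLadder
open Summit.NavierStokesRegularity.AngularGalerkinLadderLadderLimit

variable (σ : EuclideanSpace ℝ (Fin 3) ≃ₗᵢ[ℝ] EuclideanSpace ℝ (Fin 3))

/-! ## §1 The Duhamel term of an odd pair is blind to the sign -/

/-- `B^ν_s(a, b)(t)` is unchanged when both fields are replaced by fields agreeing with their
NEGATIVES on the window `(s, t)` (bilinearity of the Oseen tensor, pointwise in the integrand).
[cite: KochNadirashviliSereginSverak2009, §4 p. 8 (arXiv:0709.3599)] -/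
theorem oseenDuhamel_congr_neg_neg {ν s t : ℝ}
    {a a' b b' : ℝ → EuclideanSpace ℝ (Fin 3) → EuclideanSpace ℝ (Fin 3)}
    (ha : ∀ τ ∈ Ioo s t, ∀ y, a τ y = -a' τ y) (hb : ∀ τ ∈ Ioo s t, ∀ y, b τ y = -b' τ y)
    (x : EuclideanSpace ℝ (Fin 3)) :
    oseenDuhamel ν s a b t x = oseenDuhamel ν s a' b' t x := by
  rw [oseenDuhamel_apply, oseenDuhamel_apply]
  refine setIntegral_congr_fun measurableSet_Ioo fun τ hτ => ?_
  refine integral_congr_ae (Eventually.of_forall fun y => ?_)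
  simp only [ha τ hτ y, hb τ hτ y, oseenKernel_neg_left, oseenKernel_neg_right, neg_neg]

/-! ## §2 Parity-odd Type-I ancient mild solutions vanish -/

/-- **The Duhamel term of a parity-odd ancient mild solution vanishes**: for `s < t < 0`,
`B_s(v, v)(t) = 0`, i.e. `v(t) = e^{(t−s)Δ}v(s)`. [folklore] -/
theorem eq_heatFlow_of_parityOdd {C : ℝ}
    {v : ℝ → EuclideanSpace ℝ (Fin 3) → EuclideanSpace ℝ (Fin 3)} (hv : IsTypeIAncientMild C v)
    (hodd : ∀ t < 0, ∀ x, σ (v t (σ.symm x)) = -v t x) {s t : ℝ} (hst : s < t) (ht : t < 0)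
    (x : EuclideanSpace ℝ (Fin 3)) : v t x = heatFlow (v s) (t - s) x := by
  have hmild := hv.2.2.1
  -- the Duhamel identity at `x` and, conjugated, at `σ⁻¹ x`
  have h1 : v t x = heatFlow (v s) (t - s) x - oseenDuhamel 1 s v v t x := hmild s t hst ht x
  have h2 := congrArg σ (hmild s t hst ht (σ.symm x))
  rw [hodd t ht x, map_sub] at h2
  -- conjugating the heat flow: `σ e^{τΔ}v(s)(σ⁻¹x) = e^{τΔ}(σ̂ v(s))(x) = −e^{τΔ}v(s)(x)`
  have hs0 : s < 0 := hst.trans ht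
  have hheat : σ (heatFlow (v s) (t - s) (σ.symm x)) = -heatFlow (v s) (t - s) x := by
    rw [← heatFlow_conj_linearIsometryEquiv σ (v s) (t - s) x]
    have e : (fun y => σ (v s (σ.symm y))) = fun y => (-1 : ℝ) • v s y := by
      funext y; rw [hodd s hs0 y, neg_one_smul]
    rw [e, heatFlow_const_smul, neg_one_smul]
  -- conjugating the Duhamel term: `σ B_s(v,v)(t)(σ⁻¹x) = B_s(σ̂v, σ̂v)(t)(x) = B_s(v,v)(t)(x)`
  have hduh : σ (oseenDuhamel 1 s v v t (σ.symm x)) = oseenDuhamel 1 s v v t x := by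
    have h := oseenDuhamel_symm_conj_linearIsometryEquiv σ.symm 1 s v v t x
    simp only [LinearIsometryEquiv.symm_symm] at h
    rw [← h]
    exact oseenDuhamel_congr_neg_neg (fun τ hτ y => hodd τ (hτ.2.trans ht) y)
      (fun τ hτ y => hodd τ (hτ.2.trans ht) y) x
  rw [hheat, hduh] at h2
  -- `h1 : v = H − B`, `h2 : −v = −H − B` ⇒ `B = 0`
  have hB : oseenDuhamel 1 s v v t x = 0 := by
    have h3 : (2 : ℝ) • oseenDuhamel 1 s v v t x = 0 := by
      rw [two_smul]
      have := congrArg₂ (· + ·) h1 h2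
      simp only [add_neg_cancel] at this
      rw [eq_comm] at this
      have e : heatFlow (v s) (t - s) x - oseenDuhamel 1 s v v t x +
          (-heatFlow (v s) (t - s) x - oseenDuhamel 1 s v v t x) =
          -(oseenDuhamel 1 s v v t x + oseenDuhamel 1 s v v t x) := by abel
      rw [e, neg_eq_zero] at this
      exact this
    exact (smul_eq_zero.1 h3).resolve_left two_ne_zero
  rw [h1, hB, sub_zero]

/-- **PARITY-ODD TYPE-I ANCIENT MILD SOLUTIONS ARE TRIVIAL.** If `v` is a Type-I ancient mild
solution (KNSS gauge) and a linear isometry `σ` satisfies `σv(t, σ⁻¹x) = −v(t, x)` for all `t < 0`,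
then `v ≡ 0` on the past: `v` is caloric from every past time `s` and `‖v(t,x)‖ ≤ C/√(−s) → 0`.
[cite: KochNadirashviliSereginSverak2009, §4 p. 8 and §6 (arXiv:0709.3599)] -/
theorem typeIAncientMild_eq_zero_of_parityOdd {C : ℝ}
    {v : ℝ → EuclideanSpace ℝ (Fin 3) → EuclideanSpace ℝ (Fin 3)} (hv : IsTypeIAncientMild C v)
    (hodd : ∀ t < 0, ∀ x, σ (v t (σ.symm x)) = -v t x) : ∀ t < 0, ∀ x, v t x = 0 := by
  intro t ht x
  have hrate := hv.2.2.2
  -- `‖v t x‖ ≤ C/√(−s)` for every `s < t`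
  have hle : ∀ s < t, ‖v t x‖ ≤ C / Real.sqrt (-s) := fun s hs => by
    rw [eq_heatFlow_of_parityOdd σ hv hodd hs ht x]
    exact norm_heatFlow_le_of_bound (fun y => hrate s (hs.trans ht) y) (t - s) x
  -- let `s → −∞`
  have hlim : Tendsto (fun s : ℝ => C / Real.sqrt (-s)) atBot (𝓝 0) := by
    have h1 : Tendsto (fun s : ℝ => Real.sqrt (-s)) atBot atTop :=
      Real.tendsto_sqrt_atTop.comp tendsto_neg_atBot_atTop
    have h2 : Tendsto (fun s : ℝ => C * (Real.sqrt (-s))⁻¹) atBot (𝓝 (C * 0)) :=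
      h1.inv_tendsto_atTop.const_mul C
    rw [mul_zero] at h2
    refine h2.congr' (Eventually.of_forall fun s => ?_)
    simp [div_eq_mul_inv]
  have h0 : ‖v t x‖ ≤ 0 :=
    ge_of_tendsto hlim (Filter.eventually_of_mem (Iio_mem_atBot t) fun s hs => hle s hs)
  exact norm_le_zero_iff.1 h0

/-- **EVEN Type-I ancient mild solutions are trivial** (`σ = −1`: `v(t, −x) = v(t, x)`).
[folklore] -/
theorem typeIAncientMild_eq_zero_of_even {C : ℝ}
    {v : ℝ → EuclideanSpace ℝ (Fin 3) → EuclideanSpace ℝ (Fin 3)} (hv : IsTypeIAncientMild C v)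
    (heven : ∀ t < 0, ∀ x, v t (-x) = v t x) : ∀ t < 0, ∀ x, v t x = 0 :=
  typeIAncientMild_eq_zero_of_parityOdd (LinearIsometryEquiv.neg ℝ) hv fun t ht x => by
    simp [LinearIsometryEquiv.symm_neg, LinearIsometryEquiv.coe_neg, heven t ht]

/-! ## §3 The stratum: no window sequence is asymptotically parity-odd -/

variable {C₀ cmin cmax δ : ℝ} {L : ℕ → ℕ} {ε c : ℕ → ℝ}
  {R : ℕ → (EuclideanSpace ℝ (Fin 3) ≃ₗᵢ[ℝ] EuclideanSpace ℝ (Fin 3))}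
  {u : ℕ → ℝ → EuclideanSpace ℝ (Fin 3) → EuclideanSpace ℝ (Fin 3)}
  {p : ℕ → ℝ → EuclideanSpace ℝ (Fin 3) → ℝ}
  {d : ℕ → ℝ → EuclideanSpace ℝ (Fin 3) → EuclideanSpace ℝ (Fin 3)}

/-- **NO ADMISSIBLE WINDOW SEQUENCE IS ASYMPTOTICALLY PARITY-ODD.** For a linear isometry `σ`:
if `σuₙ(t, σ⁻¹x) + uₙ(t, x) → 0` pointwise on `t < 0` along an admissible window sequence, the
ladder limit (`exists_ladderLimit_typeI`) is a parity-odd Type-I ancient mild solution, hence zero —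
contradicting the floor `δ ≤ ‖v(−1, x₀)‖`. [cite: KochNadirashviliSereginSverak2009, Lemma 6.1 (limits of rescaled solutions)] -/
theorem no_windowSequence_asymptoticallyParityOdd (hcmin : 1 < cmin) (hδ : 0 < δ)
    (hε : Tendsto ε atTop (𝓝 0))
    (hW : ∀ n, IsWindowProfile (L n) C₀ cmin cmax δ (ε n) (c n) (R n) (u n) (p n) (d n))
    (hdef : ∀ t < 0, ∀ x, Tendsto (fun n => σ (u n t (σ.symm x)) + u n t x) atTop (𝓝 0)) :
    False := by
  obtain ⟨φ, c', R', v, hφ, -, -, -, hptw, -, -, -, hmild, -, -, -, ⟨x₀, hx₀⟩, -⟩ :=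
    exists_ladderLimit_typeI hcmin hδ hε hW
  have hodd : ∀ t < 0, ∀ x, σ (v t (σ.symm x)) = -v t x := by
    intro t ht x
    have h1 : Tendsto (fun n => σ (u (φ n) t (σ.symm x)) + u (φ n) t x) atTop
        (𝓝 (σ (v t (σ.symm x)) + v t x)) :=
      ((σ.continuous.tendsto _).comp (hptw t ht (σ.symm x))).add (hptw t ht x)
    have h0 : σ (v t (σ.symm x)) + v t x = 0 :=
      tendsto_nhds_unique h1 ((hdef t ht x).comp hφ.tendsto_atTop)
    exact eq_neg_of_add_eq_zero_left h0
  have hz := typeIAncientMild_eq_zero_of_parityOdd σ hmild hodd (-1) (by norm_num) x₀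
  rw [hz, norm_zero] at hx₀
  exact absurd hx₀ (not_le.2 hδ)

/-- **No admissible window sequence is ASYMPTOTICALLY EVEN**: `uₙ(t, x) − uₙ(t, −x) → 0` pointwise
on `t < 0` is excluded. [folklore] -/
theorem no_windowSequence_asymptoticallyEven (hcmin : 1 < cmin) (hδ : 0 < δ)
    (hε : Tendsto ε atTop (𝓝 0))
    (hW : ∀ n, IsWindowProfile (L n) C₀ cmin cmax δ (ε n) (c n) (R n) (u n) (p n) (d n))
    (hdef : ∀ t < 0, ∀ x, Tendsto (fun n => u n t x - u n t (-x)) atTop (𝓝 0)) : False := by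
  refine no_windowSequence_asymptoticallyParityOdd (LinearIsometryEquiv.neg ℝ) hcmin hδ hε hW
    fun t ht x => ?_
  have e : (fun n => (LinearIsometryEquiv.neg ℝ) (u n t ((LinearIsometryEquiv.neg ℝ
      (E := EuclideanSpace ℝ (Fin 3))).symm x)) + u n t x) = fun n => u n t x - u n t (-x) := by
    funext n
    simp [LinearIsometryEquiv.symm_neg, LinearIsometryEquiv.coe_neg]
    abel
  rw [e]
  exact hdef t ht x

/-- **Exactly parity-odd members are excluded too** (one member `n` with `σuₙ(t,σ⁻¹x) = −uₙ(t,x)`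
already contradicts the floor: apply the Liouville theorem to the constant… — here simply via the
profile-level statement: such a window profile is a parity-odd Type-I rung profile; we record the
sequence-level census form with the asymptotic hypothesis, which contains the exact case). -/
theorem no_windowSequence_asymptoticallyParityOdd_census (hcmin : 1 < cmin) (hδ : 0 < δ)
    (hε : Tendsto ε atTop (𝓝 0))
    (hW : ∀ n, IsWindowProfile (L n) C₀ cmin cmax δ (ε n) (c n) (R n) (u n) (p n) (d n)) :
    ¬ ∃ σ : EuclideanSpace ℝ (Fin 3) ≃ₗᵢ[ℝ] EuclideanSpace ℝ (Fin 3),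
        ∀ t < 0, ∀ x, Tendsto (fun n => σ (u n t (σ.symm x)) + u n t x) atTop (𝓝 0) :=
  fun ⟨σ, hdef⟩ => no_windowSequence_asymptoticallyParityOdd σ hcmin hδ hε hW hdef

/-- **(census form) not asymptotically even.** [folklore] -/
theorem no_windowSequence_asymptoticallyEven_census (hcmin : 1 < cmin) (hδ : 0 < δ)
    (hε : Tendsto ε atTop (𝓝 0))
    (hW : ∀ n, IsWindowProfile (L n) C₀ cmin cmax δ (ε n) (c n) (R n) (u n) (p n) (d n)) :
    ¬ (∀ t < 0, ∀ x, Tendsto (fun n => u n t x - u n t (-x)) atTop (𝓝 0)) :=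
  fun hdef => no_windowSequence_asymptoticallyEven hcmin hδ hε hW hdef

end Summit.NavierStokesRegularity.AngularGalerkinLadderParityOddWindowsExcluded

end
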